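import Summits.Ventures.Crystal3D.Theorems.StickyWulffConstantTextureLiminfTexShadowPiecedSealing
import Summits.Ventures.Crystal3D.Theorems.StickyWulffConstantTextureLiminfTexShadowFaultInvisibility
import Summits.Ventures.Crystal3D.Theorems.StickyWulffConstantTextureBuildBarlowShells
import HarnessLib

/-!
# TexShadow (V) PIECED PLATES, P3: the CLEAN SHOCKLEY SEAM is locally a Barlow stacking, collar sets, and the plate-data predicate `PiecedPlateData`
# (lane T, crux `TextureLiminfV5`, stmt-Ventures-23912; cf-p1 (clxi) 2026-08-29T08:13:12Z, (cxcviii) 10:12:25Z: shape ACCEPTED with `k − 1` segments and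
#  per-plate `ℓ`; design memo HOME/wall-p2-g12/PIECED-DESIGN-0.md; successor brief (ccv) item (2))

HONEST FRAMING. Venture `Summits/Ventures/Crystal3D` (cell `crystal3d-full`), route `route-Ventures-StickyWulffConstant`, helper
`--supports` the law-v5 crux `TextureLiminfV5` (stmt-Ventures-23912).  Pure Barlow-stacking bookkeeping + two definitions; standard axioms; no wall
law is asserted; rung F-C1 not moved.

THE POINT.  P2 (`…TexShadowPiecedSealing`) reduced the two non-local uses of «plate = ONE stacking» (sealing (S′), frame identification (F′)) to the
pointwise predicate `LocallyBarlowAt S L q` («on the closed unit ball about `q`, `S` is a Hägg stacking of the lattice `L·Λ₀`»).  This file supplies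
(1) the one geometric fact that makes CLEAN seams data-free and (2) the plate-data predicate the pieced K1a glue (P5) will take as hypothesis.

(1) **A clean Shockley seam IS a Barlow stacking.**  Fix an fcc presentation `(G, t)` (frame `G`, origin `t`; the fcc stacking `stacking G t constHagg`
is the lattice coset `G·Λ₀ + t`, `stacking_constHagg_eq`, and depends on `G` only through the lattice `G·Λ₀`, `stacking_constHagg_eq_of_lattice_eq`) and a
layer gap `(k₀ − 1, k₀)` of its `G e₃`-layers.  The LOWER coset piece `faultLower G t k₀` (sites of `G·Λ₀ + t` of `G e₃`-height `< (k₀ − ½)√(2/3)` above `t`)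
together with the UPPER piece `faultUpper G t k₀` (sites of the coset SHIFTED BY THE SHOCKLEY PARTIAL `G w`, `w = barlowOffset 1 = (½, √3/6, 0)`, `|w| = 1/√3`,
of height `> (k₀ − ½)√(2/3)`) is EXACTLY the Hägg stacking of the single-fault word `faultWord k₀` (`−1` at `k₀ − 1`, `+1` elsewhere) in the frame `G`:
**`faultLower_union_faultUpper : faultLower G t k₀ ∪ faultUpper G t k₀ = stacking G (t − faultShift k₀ • G w) (faultWord k₀)`**
(label bookkeeping: `haggLabel (faultWord k₀) k = k + δ` below the gap and `= k + δ − 2` above it, `δ = faultShift k₀`; `−2w ≡ +w` modulo the layer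
lattice since `3w = u + v`).  Hence **`locallyBarlowAt_of_cleanShockleySeam`**: if `G·Λ₀ = L·Λ₀` (an inclined — or the basal — frame of the plate's own
lattice) and `S` agrees with `faultLower ∪ faultUpper` on some `N ⊇ closedBall q 1`, then `LocallyBarlowAt S L q`.  (The other sign of the partial is the
same statement read downward: `lower = upper − G w`.)  So an intrinsic inclined fault crossing an fcc run of a plate is a CLEAN seam between two coset
pieces of ONE orientation, and TB discharges regularity there with no collar and no data; misfit seams (any other offset, interlopers) are collars.

(2) **Collar sets and plate data** (cf-p1 (cxcviii)): `IsCollarSet m ℓ K` := `K` lies in the radius-`2` tubes of at most `m` segments of total length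
`≤ ℓ`; `PiecedPlateRegular K L σ k s D` := `IsHaggSeq σ` ∧ territories pairwise disjoint ∧ `UnitSeparated (piecedStacking L σ k s D)` ∧
`∀ q ∉ K, LocallyBarlowAt (piecedStacking L σ k s D) L q` (shape-free core, what the glue P5 consumes together with a row count for `K`);
**`PiecedPlateData L σ k s D ℓ := ∃ K, IsCollarSet (k − 1) ℓ K ∧ PiecedPlateRegular K L σ k s D`** — one seam per adjacent piece pair, `ℓ` per plate; for `k = 1`,
territory `univ`, `ℓ = 0` it HOLDS for every Hägg word (`piecedPlateData_one`, `K = ∅`), matching `bilayerWallPiecedAt_one_iff`.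
WHAT THIS IS NOT: no walker statement, no row count (P4), no glue (P5), no certificate; whether a given configuration's seam IS clean is TB's to show
(this file gives the target shape `faultLower ∪ faultUpper`); F-C1 not moved.
-/

noncomputable section

open scoped BigOperators InnerProductSpace ENNReal
open MeasureTheory Filter

namespace Summit.Ventures.Crystal3D.Cruxes.TextureLiminf.TexShadow

open Summit.Ventures.Crystal3D Summit.Ventures.Crystal3D.Theorems
open Literature.MathematicalPhysics.StatisticalMechanics (IsHaggSeq fccStacking barlowStacking barlowPos barlowOffset haggLabel constHagg
  haggLabel_const haggLabel_succ isHaggSeq_const barlowPos_apply_two triangularVec₁ triangularVec₂ layerNormal)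

/-! ## §1 The single-fault word and its labels -/

/-- **The single-fault Hägg word**: `−1` at `k₀ − 1` (the fault sits in the layer gap `(k₀ − 1, k₀)`), `+1` elsewhere. -/
def faultWord (k₀ : ℤ) : ℤ → ℤ := fun n => if n = k₀ - 1 then -1 else 1

/-- The single-fault word is a Hägg word. -/
theorem isHaggSeq_faultWord (k₀ : ℤ) : IsHaggSeq (faultWord k₀) := by
  intro n
  unfold faultWord
  split_ifs
  · exact Or.inr rfl
  · exact Or.inl rfl

/-- Off the fault the letter is `+1`. -/
theorem faultWord_of_ne {k₀ n : ℤ} (h : n ≠ k₀ - 1) : faultWord k₀ n = 1 := if_neg h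

/-- At the fault the letter is `−1`. -/
theorem faultWord_self (k₀ : ℤ) : faultWord k₀ (k₀ - 1) = -1 := if_pos rfl

/-- The label shift of the fault word accumulated BELOW the fault, relative to the fcc labels (`0` for `k₀ ≥ 1`, `2` for `k₀ ≤ 0` — only its existence
matters: it is absorbed into the origin). -/
def faultShift (k₀ : ℤ) : ℤ := haggLabel (faultWord k₀) (k₀ - 1) - (k₀ - 1)

/-- **Below the fault** the labels are the fcc labels shifted by `faultShift`: `haggLabel (faultWord k₀) k = k + faultShift k₀` for `k ≤ k₀ − 1`. -/
theorem haggLabel_faultWord_of_le {k₀ k : ℤ} (hk : k ≤ k₀ - 1) : haggLabel (faultWord k₀) k = k + faultShift k₀ := by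
  have h := haggLabel_sub_eq_of_agree (s := faultWord k₀) (s' := constHagg) hk
    (fun i _ hi => (faultWord_of_ne (by omega)).trans rfl)
  rw [haggLabel_const, haggLabel_const] at h
  unfold faultShift
  omega

/-- **Above the fault** the labels are shifted by `faultShift − 2`: `haggLabel (faultWord k₀) k = k + faultShift k₀ − 2` for `k₀ ≤ k`. -/
theorem haggLabel_faultWord_of_ge {k₀ k : ℤ} (hk : k₀ ≤ k) : haggLabel (faultWord k₀) k = k + faultShift k₀ - 2 := by
  have h := haggLabel_sub_eq_of_agree (s := faultWord k₀) (s' := constHagg) hk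
    (fun i hi _ => (faultWord_of_ne (by omega)).trans rfl)
  rw [haggLabel_const, haggLabel_const] at h
  have h0 : haggLabel (faultWord k₀) k₀ = haggLabel (faultWord k₀) (k₀ - 1) + faultWord k₀ (k₀ - 1) := by
    have := haggLabel_succ (faultWord k₀) (k₀ - 1)
    rwa [sub_add_cancel] at this
  rw [faultWord_self] at h0
  unfold faultShift
  omega

/-! ## §2 The layers of the fault stacking are shifted fcc layers -/

/-- `3 w = u + v` at spacing `1`, coordinatewise: the offset `w = barlowOffset 1` has coordinates `(½, √3/6, 0)`. -/
theorem barlowOffset_one_apply_two : (barlowOffset (1 : ℝ)) 2 = 0 := by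
  simp [barlowOffset]

/-- **Below the fault**: `barlowPos (faultWord k₀) k i j = barlowPos constHagg k i j + faultShift k₀ • w` (`k ≤ k₀ − 1`). -/
theorem barlowPos_faultWord_of_le {k₀ k : ℤ} (hk : k ≤ k₀ - 1) (a c : ℝ) (i j : ℤ) :
    barlowPos a c (faultWord k₀) k i j = barlowPos a c constHagg k i j + ((faultShift k₀ : ℤ) : ℝ) • barlowOffset a := by
  have hlab : (haggLabel (faultWord k₀) k - haggLabel constHagg k : ℤ) = faultShift k₀ := by
    rw [haggLabel_faultWord_of_le hk, haggLabel_const]; ring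
  rw [barlowPos_eq_add_of_agree (s := faultWord k₀) (s' := constHagg) a c (le_refl k) (fun _ h1 h2 => (not_lt.2 h1 h2).elim) i j, hlab]

/-- **Above the fault**: `barlowPos (faultWord k₀) k (i + 1) (j + 1) = barlowPos constHagg k i j + (faultShift k₀ + 1) • w` (`k₀ ≤ k`): the label shift
`faultShift − 2` is `faultShift + 1` up to the layer-lattice vector `3w = u + v`. -/
theorem barlowPos_faultWord_of_ge {k₀ k : ℤ} (hk : k₀ ≤ k) (a c : ℝ) (i j : ℤ) :
    barlowPos a c (faultWord k₀) k (i + 1) (j + 1) = barlowPos a c constHagg k i j + ((faultShift k₀ + 1 : ℤ) : ℝ) • barlowOffset a := by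
  have hlab := haggLabel_faultWord_of_ge hk
  ext l
  fin_cases l <;> simp [barlowOffset, hlab] <;> ring

/-- The same, read with the indices on the fcc side shifted: `barlowPos (faultWord k₀) k i j = barlowPos constHagg k (i − 1) (j − 1) + (faultShift k₀ + 1) • w`. -/
theorem barlowPos_faultWord_of_ge' {k₀ k : ℤ} (hk : k₀ ≤ k) (a c : ℝ) (i j : ℤ) :
    barlowPos a c (faultWord k₀) k i j = barlowPos a c constHagg k (i - 1) (j - 1) + ((faultShift k₀ + 1 : ℤ) : ℝ) • barlowOffset a := by
  have := barlowPos_faultWord_of_ge hk a c (i - 1) (j - 1)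
  rwa [sub_add_cancel, sub_add_cancel] at this

/-! ## §3 The two coset pieces of a clean Shockley seam and their union -/

/-- **fcc presentation = lattice coset**: `stacking G t constHagg = (G·Λ₀) + t`. -/
theorem stacking_constHagg_eq (G : E3 ≃ₗᵢ[ℝ] E3) (t : E3) :
    stacking G t constHagg = (fun y => y + t) '' (G '' fccStacking 1 (Real.sqrt (2 / 3))) := by
  unfold stacking fccStacking
  rw [Set.image_image]

/-- **Frames of the same lattice present the same fcc stacking**: `G·Λ₀ = L·Λ₀ ⇒ stacking G t constHagg = stacking L t constHagg`. -/
theorem stacking_constHagg_eq_of_lattice_eq {G L : E3 ≃ₗᵢ[ℝ] E3}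
    (hGL : G '' fccStacking 1 (Real.sqrt (2 / 3)) = L '' fccStacking 1 (Real.sqrt (2 / 3))) (t : E3) :
    stacking G t constHagg = stacking L t constHagg := by
  rw [stacking_constHagg_eq, stacking_constHagg_eq, hGL]

/-- **LOWER coset piece** of a clean single fault of the fcc presentation `(G, t)` across the layer gap `(k₀ − 1, k₀)`: the sites of the coset
`stacking G t constHagg = G·Λ₀ + t` of `G e₃`-height `< (k₀ − ½)·√(2/3)` above `t` (i.e. its `G e₃`-layers `≤ k₀ − 1`). -/
def faultLower (G : E3 ≃ₗᵢ[ℝ] E3) (t : E3) (k₀ : ℤ) : Set E3 :=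
  {x | x ∈ stacking G t constHagg ∧ ⟪x - t, G e₃⟫_ℝ < ((k₀ : ℝ) - 1 / 2) * Real.sqrt (2 / 3)}

/-- **UPPER coset piece**: the sites of the coset SHIFTED BY THE SHOCKLEY PARTIAL, `stacking G (t + G w) constHagg = G·Λ₀ + G w + t`
(`w = barlowOffset 1 = (½, √3/6, 0)`, in-plane, `|w| = 1/√3`), of `G e₃`-height `> (k₀ − ½)·√(2/3)` above `t` (layers `≥ k₀`). -/
def faultUpper (G : E3 ≃ₗᵢ[ℝ] E3) (t : E3) (k₀ : ℤ) : Set E3 :=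
  {x | x ∈ stacking G (t + G (barlowOffset 1)) constHagg ∧ ((k₀ : ℝ) - 1 / 2) * Real.sqrt (2 / 3) < ⟪x - t, G e₃⟫_ℝ}

/-- Height above `t` along `G e₃` of a presented point `G r + t`: the model third coordinate `r₂`. -/
theorem inner_presented_sub_e₃ (G : E3 ≃ₗᵢ[ℝ] E3) (r t : E3) : ⟪G r + t - t, G e₃⟫_ℝ = r 2 := by
  rw [add_sub_cancel_right, LinearIsometryEquiv.inner_map_map]
  exact inner_single_two_one r

/-- Height above `t` along `G e₃` of a Shockley-shifted presented point `G r + G w + t`: still `r₂` (`w₂ = 0`). -/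
theorem inner_presented_shift_sub_e₃ (G : E3 ≃ₗᵢ[ℝ] E3) (r t : E3) :
    ⟪G r + G (barlowOffset 1) + t - t, G e₃⟫_ℝ = r 2 := by
  rw [add_sub_cancel_right, ← LinearIsometryEquiv.map_add, LinearIsometryEquiv.inner_map_map]
  show ⟪r + barlowOffset 1, EuclideanSpace.single (2 : Fin 3) (1 : ℝ)⟫_ℝ = r 2
  rw [inner_single_two_one, PiLp.add_apply, barlowOffset_one_apply_two, add_zero]

/-- Layer index `≤ k₀ − 1` iff height `< (k₀ − ½)√(2/3)`. -/
theorem layer_lt_cut_iff (k k₀ : ℤ) :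
    (k : ℝ) * Real.sqrt (2 / 3) < ((k₀ : ℝ) - 1 / 2) * Real.sqrt (2 / 3) ↔ k ≤ k₀ - 1 := by
  have hd : 0 < Real.sqrt (2 / 3) := Real.sqrt_pos.2 (by norm_num)
  rw [mul_lt_mul_iff_left₀ hd]
  constructor
  · intro h
    by_contra hk
    have : (k₀ : ℝ) ≤ k := by exact_mod_cast (show k₀ ≤ k by omega)
    linarith
  · intro h
    have : (k : ℝ) ≤ k₀ - 1 := by exact_mod_cast (show k ≤ k₀ - 1 from h)
    linarith

/-- Layer index `≥ k₀` iff height `> (k₀ − ½)√(2/3)`. -/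
theorem cut_lt_layer_iff (k k₀ : ℤ) :
    ((k₀ : ℝ) - 1 / 2) * Real.sqrt (2 / 3) < (k : ℝ) * Real.sqrt (2 / 3) ↔ k₀ ≤ k := by
  have hd : 0 < Real.sqrt (2 / 3) := Real.sqrt_pos.2 (by norm_num)
  rw [mul_lt_mul_iff_left₀ hd]
  constructor
  · intro h
    by_contra hk
    have : (k : ℝ) ≤ k₀ - 1 := by exact_mod_cast (show k ≤ k₀ - 1 by omega)
    linarith
  · intro h
    have : (k₀ : ℝ) ≤ k := by exact_mod_cast h
    linarith

/-- Membership in the lower piece. -/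
theorem mem_faultLower_iff (G : E3 ≃ₗᵢ[ℝ] E3) (t : E3) (k₀ : ℤ) (x : E3) :
    x ∈ faultLower G t k₀ ↔ x ∈ stacking G t constHagg ∧ ⟪x - t, G e₃⟫_ℝ < ((k₀ : ℝ) - 1 / 2) * Real.sqrt (2 / 3) :=
  Iff.rfl

/-- Membership in the upper piece. -/
theorem mem_faultUpper_iff (G : E3 ≃ₗᵢ[ℝ] E3) (t : E3) (k₀ : ℤ) (x : E3) :
    x ∈ faultUpper G t k₀ ↔
      x ∈ stacking G (t + G (barlowOffset 1)) constHagg ∧ ((k₀ : ℝ) - 1 / 2) * Real.sqrt (2 / 3) < ⟪x - t, G e₃⟫_ℝ :=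
  Iff.rfl

/-- **A CLEAN SHOCKLEY SEAM IS A BARLOW STACKING**: the lower coset piece and the Shockley-shifted upper coset piece of the fcc presentation `(G, t)`
across the layer gap `(k₀ − 1, k₀)` form EXACTLY the Hägg stacking of the single-fault word in the frame `G` (origin re-anchored by `−faultShift k₀ • G w`). -/
theorem faultLower_union_faultUpper (G : E3 ≃ₗᵢ[ℝ] E3) (t : E3) (k₀ : ℤ) :
    faultLower G t k₀ ∪ faultUpper G t k₀ =
      stacking G (t - ((faultShift k₀ : ℤ) : ℝ) • G (barlowOffset 1)) (faultWord k₀) := by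
  ext x
  rw [Set.mem_union, mem_faultLower_iff, mem_faultUpper_iff]
  constructor
  · rintro (⟨hx, hlt⟩ | ⟨hx, hgt⟩)
    · -- a lower site: layer `k ≤ k₀ − 1`
      obtain ⟨r, ⟨k, i, j, rfl⟩, rfl⟩ := hx
      dsimp only at hlt ⊢
      have hh := inner_presented_sub_e₃ G (barlowPos 1 (Real.sqrt (2 / 3)) constHagg k i j) t
      rw [barlowPos_apply_two] at hh
      rw [hh, layer_lt_cut_iff] at hlt
      refine ⟨barlowPos 1 (Real.sqrt (2 / 3)) (faultWord k₀) k i j, ⟨k, i, j, rfl⟩, ?_⟩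
      dsimp only
      rw [barlowPos_faultWord_of_le hlt, LinearIsometryEquiv.map_add, LinearIsometryEquiv.map_smul]
      abel
    · -- an upper site: layer `k ≥ k₀`
      obtain ⟨r, ⟨k, i, j, rfl⟩, rfl⟩ := hx
      dsimp only at hgt ⊢
      have hh := inner_presented_shift_sub_e₃ G (barlowPos 1 (Real.sqrt (2 / 3)) constHagg k i j) t
      rw [barlowPos_apply_two,
        show G (barlowPos 1 (Real.sqrt (2 / 3)) constHagg k i j) + G (barlowOffset 1) + t =
          G (barlowPos 1 (Real.sqrt (2 / 3)) constHagg k i j) + (t + G (barlowOffset 1)) by abel] at hh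
      rw [hh, cut_lt_layer_iff] at hgt
      refine ⟨barlowPos 1 (Real.sqrt (2 / 3)) (faultWord k₀) k (i + 1) (j + 1), ⟨k, i + 1, j + 1, rfl⟩, ?_⟩
      dsimp only
      rw [barlowPos_faultWord_of_ge hgt, LinearIsometryEquiv.map_add, LinearIsometryEquiv.map_smul, Int.cast_add, Int.cast_one,
        add_smul, one_smul]
      abel
  · rintro ⟨r, ⟨k, i, j, rfl⟩, rfl⟩
    dsimp only
    rcases le_or_gt k (k₀ - 1) with hk | hk
    · -- layer below the gap: a lower site
      left
      refine ⟨⟨barlowPos 1 (Real.sqrt (2 / 3)) constHagg k i j, ⟨k, i, j, rfl⟩, ?_⟩, ?_⟩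
      · dsimp only
        rw [barlowPos_faultWord_of_le hk, LinearIsometryEquiv.map_add, LinearIsometryEquiv.map_smul]
        abel
      · have hh := inner_presented_sub_e₃ G (barlowPos 1 (Real.sqrt (2 / 3)) constHagg k i j) t
        rw [barlowPos_apply_two] at hh
        rw [barlowPos_faultWord_of_le hk, LinearIsometryEquiv.map_add, LinearIsometryEquiv.map_smul,
          show G (barlowPos 1 (Real.sqrt (2 / 3)) constHagg k i j) + ((faultShift k₀ : ℤ) : ℝ) • G (barlowOffset 1) +
              (t - ((faultShift k₀ : ℤ) : ℝ) • G (barlowOffset 1)) =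
            G (barlowPos 1 (Real.sqrt (2 / 3)) constHagg k i j) + t by abel, hh, layer_lt_cut_iff]
        exact hk
    · -- layer above the gap: an upper site
      have hk' : k₀ ≤ k := by omega
      right
      refine ⟨⟨barlowPos 1 (Real.sqrt (2 / 3)) constHagg k (i - 1) (j - 1), ⟨k, i - 1, j - 1, rfl⟩, ?_⟩, ?_⟩
      · dsimp only
        rw [barlowPos_faultWord_of_ge' hk', LinearIsometryEquiv.map_add, LinearIsometryEquiv.map_smul, Int.cast_add, Int.cast_one,
          add_smul, one_smul]
        abel
      · have hh := inner_presented_shift_sub_e₃ G (barlowPos 1 (Real.sqrt (2 / 3)) constHagg k (i - 1) (j - 1)) t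
        rw [barlowPos_apply_two] at hh
        rw [barlowPos_faultWord_of_ge' hk', LinearIsometryEquiv.map_add, LinearIsometryEquiv.map_smul, Int.cast_add, Int.cast_one,
          add_smul, one_smul,
          show G (barlowPos 1 (Real.sqrt (2 / 3)) constHagg k (i - 1) (j - 1)) +
              (((faultShift k₀ : ℤ) : ℝ) • G (barlowOffset 1) + G (barlowOffset 1)) +
              (t - ((faultShift k₀ : ℤ) : ℝ) • G (barlowOffset 1)) =
            G (barlowPos 1 (Real.sqrt (2 / 3)) constHagg k (i - 1) (j - 1)) + G (barlowOffset 1) + t by abel, hh, cut_lt_layer_iff]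
        exact hk'

/-- **CLEAN SHOCKLEY SEAM ⇒ LOCALLY BARLOW** (the lemma P3 owes TB, cf-p1 (cxcviii)): if `G` is a frame of the plate's lattice (`G·Λ₀ = L·Λ₀`; for an
inclined seam `G e₃` is an inclined `{111}` normal of `L·Λ₀`) and, on some `N ⊇ closedBall q 1`, the pieced plate `S` consists of the lower coset piece and
the Shockley-shifted upper coset piece of `(G, t)` across a layer gap, then `S` is locally Barlow at `q` — no collar, no data. -/
theorem locallyBarlowAt_of_cleanShockleySeam {S N : Set E3} {L G : E3 ≃ₗᵢ[ℝ] E3}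
    (hGL : G '' fccStacking 1 (Real.sqrt (2 / 3)) = L '' fccStacking 1 (Real.sqrt (2 / 3))) (t : E3) (k₀ : ℤ) {q : E3}
    (hN : Metric.closedBall q 1 ⊆ N) (hS : S ∩ N = (faultLower G t k₀ ∪ faultUpper G t k₀) ∩ N) :
    LocallyBarlowAt S L q :=
  ⟨N, G, _, faultWord k₀, isHaggSeq_faultWord k₀, hN, hGL, by rw [hS, faultLower_union_faultUpper]⟩

/-- In particular the WHOLE clean-seam configuration `faultLower ∪ faultUpper` is locally Barlow everywhere. -/
theorem locallyBarlowAt_faultLower_union_faultUpper {L G : E3 ≃ₗᵢ[ℝ] E3}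
    (hGL : G '' fccStacking 1 (Real.sqrt (2 / 3)) = L '' fccStacking 1 (Real.sqrt (2 / 3))) (t : E3) (k₀ : ℤ) (q : E3) :
    LocallyBarlowAt (faultLower G t k₀ ∪ faultUpper G t k₀) L q :=
  locallyBarlowAt_of_cleanShockleySeam hGL t k₀ (Set.subset_univ _) (N := Set.univ) rfl

/-! ## §4 Collar sets and the plate-data predicate -/

/-- **Collar set of at most `m` segments of total length `≤ ℓ`**: `K` lies in the union of the radius-`2` tubes about at most `m` segments
`[a i, b i]` with `Σ dist (a i) (b i) ≤ ℓ` (the MISFIT COLLARS of a pieced plate; clean seams contribute nothing). -/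
def IsCollarSet (m : ℕ) (ℓ : ℝ) (K : Set E3) : Prop :=
  ∃ (n : ℕ) (a b : Fin n → E3), n ≤ m ∧ ∑ i, dist (a i) (b i) ≤ ℓ ∧
    K ⊆ {q | ∃ i : Fin n, ∃ x ∈ segment ℝ (a i) (b i), dist q x ≤ 2}

/-- The empty collar set (`ℓ ≥ 0`, any `m`). -/
theorem isCollarSet_empty (m : ℕ) {ℓ : ℝ} (hℓ : 0 ≤ ℓ) : IsCollarSet m ℓ ∅ :=
  ⟨0, Fin.elim0, Fin.elim0, Nat.zero_le m, by simpa using hℓ, Set.empty_subset _⟩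

/-- Collar sets are monotone in `m`, `ℓ` and antitone in `K`. -/
theorem IsCollarSet.mono {m m' : ℕ} {ℓ ℓ' : ℝ} {K K' : Set E3} (h : IsCollarSet m ℓ K) (hm : m ≤ m') (hℓ : ℓ ≤ ℓ') (hK : K' ⊆ K) :
    IsCollarSet m' ℓ' K' := by
  obtain ⟨n, a, b, hn, hsum, hKs⟩ := h
  exact ⟨n, a, b, hn.trans hm, hsum.trans hℓ, hK.trans hKs⟩

/-- A collar set has `ℓ ≥ 0`. -/
theorem IsCollarSet.nonneg {m : ℕ} {ℓ : ℝ} {K : Set E3} (h : IsCollarSet m ℓ K) : 0 ≤ ℓ := by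
  obtain ⟨n, a, b, -, hsum, -⟩ := h
  exact le_trans (Finset.sum_nonneg fun i _ => dist_nonneg) hsum

/-- **PIECED PLATE, REGULAR OFF `K`**: the shape-free core of the plate data — a Hägg word, pairwise disjoint territories, a unit-separated union,
and REGULARITY (`LocallyBarlowAt`, P2) at every point off the exceptional set `K` (the misfit collars).  The K1a glue P5 is stated against this
predicate plus a row count for `K`; `PiecedPlateData` fixes the accepted shape of `K`. -/
def PiecedPlateRegular (K : Set E3) (L : E3 ≃ₗᵢ[ℝ] E3) (σ : ℤ → ℤ) (k : ℕ) (s : Fin k → E3) (D : Fin k → Set E3) : Prop :=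
  IsHaggSeq σ ∧ (∀ a b : Fin k, a ≠ b → Disjoint (D a) (D b)) ∧ UnitSeparated (piecedStacking L σ k s D) ∧
    ∀ q, q ∉ K → LocallyBarlowAt (piecedStacking L σ k s D) L q

/-- **PIECED PLATE DATA** (cf-p1 (cxcviii), shape of 19480-p2 g12 10:12:15Z with the two fixes): what TB guarantees of a pieced plate
`(L, σ; k pieces, origins s, territories D; misfit-collar length ℓ)`: regular (`PiecedPlateRegular`) off a collar set of at most `k − 1` segments (one
seam per adjacent piece pair) of total length `≤ ℓ`.  Clean Shockley seams need no collar (`locallyBarlowAt_of_cleanShockleySeam`); interior points are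
regular by `locallyBarlowAt_piecedStacking_of_closedBall_subset`. -/
def PiecedPlateData (L : E3 ≃ₗᵢ[ℝ] E3) (σ : ℤ → ℤ) (k : ℕ) (s : Fin k → E3) (D : Fin k → Set E3) (ℓ : ℝ) : Prop :=
  ∃ K : Set E3, IsCollarSet (k - 1) ℓ K ∧ PiecedPlateRegular K L σ k s D

/-- Regularity off `K` is antitone in `K`. -/
theorem PiecedPlateRegular.mono {K K' : Set E3} {L : E3 ≃ₗᵢ[ℝ] E3} {σ : ℤ → ℤ} {k : ℕ} {s : Fin k → E3} {D : Fin k → Set E3}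
    (h : PiecedPlateRegular K L σ k s D) (hK : K ⊆ K') : PiecedPlateRegular K' L σ k s D :=
  ⟨h.1, h.2.1, h.2.2.1, fun q hq => h.2.2.2 q fun hqK => hq (hK hqK)⟩

/-- The word of a regular pieced plate is a Hägg word. -/
theorem PiecedPlateRegular.isHaggSeq {K : Set E3} {L : E3 ≃ₗᵢ[ℝ] E3} {σ : ℤ → ℤ} {k : ℕ} {s : Fin k → E3} {D : Fin k → Set E3}
    (h : PiecedPlateRegular K L σ k s D) : IsHaggSeq σ :=
  h.1

/-- The territories of a regular pieced plate are pairwise disjoint. -/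
theorem PiecedPlateRegular.disjoint {K : Set E3} {L : E3 ≃ₗᵢ[ℝ] E3} {σ : ℤ → ℤ} {k : ℕ} {s : Fin k → E3} {D : Fin k → Set E3}
    (h : PiecedPlateRegular K L σ k s D) : ∀ a b : Fin k, a ≠ b → Disjoint (D a) (D b) :=
  h.2.1

/-- The pieced stacking of a regular pieced plate is unit-separated. -/
theorem PiecedPlateRegular.unitSeparated {K : Set E3} {L : E3 ≃ₗᵢ[ℝ] E3} {σ : ℤ → ℤ} {k : ℕ} {s : Fin k → E3} {D : Fin k → Set E3}
    (h : PiecedPlateRegular K L σ k s D) : UnitSeparated (piecedStacking L σ k s D) :=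
  h.2.2.1

/-- Regularity off `K`. -/
theorem PiecedPlateRegular.locallyBarlowAt {K : Set E3} {L : E3 ≃ₗᵢ[ℝ] E3} {σ : ℤ → ℤ} {k : ℕ} {s : Fin k → E3} {D : Fin k → Set E3}
    (h : PiecedPlateRegular K L σ k s D) {q : E3} (hq : q ∉ K) : LocallyBarlowAt (piecedStacking L σ k s D) L q :=
  h.2.2.2 q hq

/-- The word of a pieced plate is a Hägg word. -/
theorem PiecedPlateData.isHaggSeq {L : E3 ≃ₗᵢ[ℝ] E3} {σ : ℤ → ℤ} {k : ℕ} {s : Fin k → E3} {D : Fin k → Set E3} {ℓ : ℝ}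
    (h : PiecedPlateData L σ k s D ℓ) : IsHaggSeq σ := by
  obtain ⟨K, -, hK⟩ := h
  exact hK.isHaggSeq

/-- The territories of a pieced plate are pairwise disjoint. -/
theorem PiecedPlateData.disjoint {L : E3 ≃ₗᵢ[ℝ] E3} {σ : ℤ → ℤ} {k : ℕ} {s : Fin k → E3} {D : Fin k → Set E3} {ℓ : ℝ}
    (h : PiecedPlateData L σ k s D ℓ) : ∀ a b : Fin k, a ≠ b → Disjoint (D a) (D b) := by
  obtain ⟨K, -, hK⟩ := h
  exact hK.disjoint

/-- The pieced stacking of a pieced plate is unit-separated. -/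
theorem PiecedPlateData.unitSeparated {L : E3 ≃ₗᵢ[ℝ] E3} {σ : ℤ → ℤ} {k : ℕ} {s : Fin k → E3} {D : Fin k → Set E3} {ℓ : ℝ}
    (h : PiecedPlateData L σ k s D ℓ) : UnitSeparated (piecedStacking L σ k s D) := by
  obtain ⟨K, -, hK⟩ := h
  exact hK.unitSeparated

/-- The collar length of a pieced plate is `≥ 0`. -/
theorem PiecedPlateData.nonneg {L : E3 ≃ₗᵢ[ℝ] E3} {σ : ℤ → ℤ} {k : ℕ} {s : Fin k → E3} {D : Fin k → Set E3} {ℓ : ℝ}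
    (h : PiecedPlateData L σ k s D ℓ) : 0 ≤ ℓ := by
  obtain ⟨K, hK, -⟩ := h
  exact hK.nonneg

/-- Plate data is monotone in the collar length. -/
theorem PiecedPlateData.mono {L : E3 ≃ₗᵢ[ℝ] E3} {σ : ℤ → ℤ} {k : ℕ} {s : Fin k → E3} {D : Fin k → Set E3} {ℓ ℓ' : ℝ}
    (h : PiecedPlateData L σ k s D ℓ) (hℓ : ℓ ≤ ℓ') : PiecedPlateData L σ k s D ℓ' := by
  obtain ⟨K, hK, hreg⟩ := h
  exact ⟨K, hK.mono le_rfl hℓ subset_rfl, hreg⟩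

/-- A plain moved Hägg stacking is unit-separated. -/
theorem unitSeparated_stacking {σ : ℤ → ℤ} (hσ : IsHaggSeq σ) (L : E3 ≃ₗᵢ[ℝ] E3) (s : E3) : UnitSeparated (stacking L s σ) :=
  fun _ hp _ hq hne => one_le_dist_of_mem_stacking hσ hp hq hne

/-- **One piece, territory `univ`, no collar: every Hägg plate is a pieced plate** (`k = 1`, `ℓ = 0`; with `bilayerWallPiecedAt_one_iff` the pieced K1a glue
P5 specialises to the one-piece glue). -/
theorem piecedPlateData_one {σ : ℤ → ℤ} (hσ : IsHaggSeq σ) (L : E3 ≃ₗᵢ[ℝ] E3) (s : Fin 1 → E3) :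
    PiecedPlateData L σ 1 s (fun _ => Set.univ) 0 := by
  refine ⟨∅, isCollarSet_empty 0 le_rfl, hσ, fun a b hab => absurd (Subsingleton.elim a b) hab, ?_, fun q _ => ?_⟩
  · rw [piecedStacking_one]
    exact unitSeparated_stacking hσ L (s 0)
  · rw [piecedStacking_one]
    exact locallyBarlowAt_stacking hσ L (s 0) q

/-- A plain Hägg plate (one piece, territory `univ`) is regular off EVERY `K` (in particular off `∅`). -/
theorem piecedPlateRegular_one {σ : ℤ → ℤ} (hσ : IsHaggSeq σ) (L : E3 ≃ₗᵢ[ℝ] E3) (s : Fin 1 → E3) (K : Set E3) :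
    PiecedPlateRegular K L σ 1 s (fun _ => Set.univ) := by
  refine ⟨hσ, fun a b hab => absurd (Subsingleton.elim a b) hab, ?_, fun q _ => ?_⟩
  · rw [piecedStacking_one]
    exact unitSeparated_stacking hσ L (s 0)
  · rw [piecedStacking_one]
    exact locallyBarlowAt_stacking hσ L (s 0) q

end Summit.Ventures.Crystal3D.Cruxes.TextureLiminf.TexShadow

end
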